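import Literature.Analysis.OperatorTheory.PseudoResolventTaylor
import Literature.Analysis.OperatorTheory.PseudoResolventFarField
import Literature.Analysis.Complex.WindingCertificate
import Mathlib.Analysis.InnerProductSpace.Adjoint
import HarnessLib

/-!
# Sheet-ℝ spectral certificate (Z3-SR-SPEC, S2): the STEP RULE, the CONJUGATE TRANSFER and the MIXED FAR FIELD in the kernel —
# from finitely many enclosures about the resolvent chain at ONE point to a certified boundary piece of the label certificate

HONEST FRAMING (cell ns-blowup GROUP B «PROFILE SEARCH»; PROFILE-SPEC v1.3 case Z3-SR-SPEC; 1-D MODEL (viscous gCLM/OSW sheet on `ℝ`);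
computer-assisted; not Euler/NS; «violates: none — MODEL»). Nothing here is a statement about Navier–Stokes and nothing here is interval
arithmetic. The file is ABSTRACT: `X` a complex Hilbert space, `J : ℂ → X →L[ℂ] X` a pseudo-resolvent on `U ⊆ ℂ`
(`Literature.Analysis.OperatorTheory.IsPseudoResolvent`, Kato VIII-§1.1) with an a-priori bound `‖J(w)g‖ ≤ ‖g‖/c_w` (the Gårding / pivot
bound of selfsim's `norm_resolventKC_le_inv`), `h f : X`, `θ : ℂ`, and an «Evans function» `E` with `E(w) = 1 − θ⟪h, J(w)f⟫`.
It turns implementation 2's CERTIFICATION RULE for the rectangle `K` (seat ns-blowup-profile-cert-2 g7, hub script `rect_from_json.py`,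
file `rect_from_j270205.json` f71b02691bd71b8b: «the disc of radius `E_rad + B(gap) + pert` about the computed box `E(σ_k)` lies inside the
half-plane `H_d`») into theorems, so that the hypothesis `RectLabelCertificate E*` of `SheetRSpectrumWindingAssembly` /
`SheetRSpectrumOddAssembly` reduces to FINITELY MANY SCALAR ENCLOSURES at the certificate points (the companion data file
`SheetRSpectrumPointCertificate`):
* §1 label geometry: `re_qrot_mul_pos_of_norm_sub_le` (a disc of radius `R` about `c` with `R < Re((−i)^d c)` lies in `H_d`), `qrot_neg`
  (conjugation swaps the labels `1 ↔ 3`: `(−i)^{−d} = conj((−i)^d)`);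
* §2 **the step rule** `norm_evans_sub_le_of_taylor`: from `‖E(s) − c‖ ≤ r`, `‖θ‖·|⟪h, J(s)^{j+2}f⟫| ≤ K_j (j < q)`,
  `‖θ‖·‖(J(s)†)^{q+1}h‖·‖f‖ ≤ Y` and `‖w − s‖ ≤ ρ`: `‖E(w) − c‖ ≤ r + Σ_{j<q} K_j ρ^{j+1} + Y ρ^{q+1}/c_w` — the (P7) Taylor model with
  the adjoint-chain remainder (`IsPseudoResolvent.norm_inner_apply_sub_sum_le_of_bound`, cert-5's `PseudoResolventTaylor`), i.e. exactly
  implementation 2's `B(ρ) = Σ_{1≤j<p}(|k_j| + err_j)ρ^j + θρ^p(‖ỹ_p‖ + e_p)‖h‖/c_w` with `p = q + 1`;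
* §3 **one vertical piece** `vpiece_of_taylor`: with a second function `E₁`, `‖E₁ − E‖ ≤ pert` on the piece (the (P8) `Ω* − Ω̄` allowance), and the
  rational MARGIN `r + pert + Σ K_j ρ^{j+1} + Y ρ^{q+1}/c_w < Re((−i)^d c)`: `Re((−i)^d E₁(x + iy)) > 0` for all `y ∈ [y₀, y₁] ⊆ [y_s − ρ, y_s + ρ]`
  — the `VPieces` clause of `Literature.Analysis.Complex.WindingCertificate`; §4 `disc_conj` / `vpiece_conj`: the conjugation symmetry
  `E(w̄) = conj E(w)` carries a certified disc / piece to the mirror piece with the conjugate box and the label `−d`;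
* §5 **the mixed far field** (implementation 2's form, the one whose `R₀ = 11.406` fits the rectangle): with ONE forward step `f = J(z)(g₁ + z f)`
  («`A f = g₁`») and ONE adjoint step `J(z)†(g₁′ + z̄ h) = h` («`A† h = g₁′`»), `⟪h, J(σ)f⟫ = ⟪h,f⟫/σ − ⟪h,g₁⟫/σ² + ⟪g₁′, J(σ)g₁⟫/σ²`
  (`inner_apply_eq_mixed`), hence `‖θ⟪h, J(σ)f⟫‖ ≤ ‖θ‖(‖⟪h,f⟫‖/R + ‖⟪h,g₁⟫‖/R² + ‖g₁′‖‖g₁‖/(c₀R²))` for `‖σ‖ ≥ R`, `c₀ ≤ c_σ`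
  (`norm_k_le_mixed`) and `Re E₁(σ) > 0` once that bracket `+ pert < 1` (`re_pos_of_mixed`).
§4b/§5 also fix the SHAPES of the two kinds of records as named hypotheses (`TaylorDatum`, `MixedFarDatum` — definitions of `Prop`s that
only abbreviate the conjunction of the enclosures above; for the sheet they ARE implementation 2's interval arithmetic and are NOT proved here)
with the piece rules keyed on them (`vpiece_of_datum`, `vpiece_conj_of_datum`, `re_pos_of_mixedDatum`).
Pure functional analysis + bookkeeping; two abbreviating `Prop` definitions, no named fact, no number of record. WHAT THIS IS NOT: not NS;
not the certificate — no enclosure is proved here.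
-/

noncomputable section

namespace Summit.NavierStokesRegularity.OSWSelfSimilar
namespace SheetRSpectrumStepRule

open Literature.Analysis.OperatorTheory Literature.Analysis.Complex Complex Set
open scoped ComplexConjugate InnerProductSpace

/-! ### §1 Label geometry -/

/-- **A disc inside a label half-plane**: `‖w − c‖ ≤ R` and `R < Re((−i)^d c)` give `Re((−i)^d w) > 0`. [folklore] -/
theorem re_qrot_mul_pos_of_norm_sub_le {d : Fin 4} {w c : ℂ} {R : ℝ} (h : ‖w - c‖ ≤ R) (hR : R < (qrot d * c).re) :
    0 < (qrot d * w).re := by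
  have h1 : (qrot d * w).re = (qrot d * c).re + (qrot d * (w - c)).re := by
    rw [← Complex.add_re, ← mul_add, add_sub_cancel]
  -- `‖(−i)^d‖ = 1` (also `Literature.NumberTheory.LFunctions.ZetaCert.norm_qrot`; one line, not worth the import)
  have hq : ‖qrot d‖ = 1 := by fin_cases d <;> simp [qrot]
  have h2 : |(qrot d * (w - c)).re| ≤ R :=
    (Complex.abs_re_le_norm _).trans (by rw [norm_mul, hq, one_mul]; exact h)
  rw [h1]
  linarith [neg_abs_le (qrot d * (w - c)).re]

/-- Conjugation swaps the labels `1 ↔ 3` and fixes `0, 2`: `(−i)^{−d} = conj((−i)^d)`. [folklore] -/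
theorem qrot_neg (d : Fin 4) : qrot (-d) = conj (qrot d) := by
  fin_cases d <;> simp [qrot] <;> rfl

/-- `Re((−i)^{−d} · conj c) = Re((−i)^d · c)`. [folklore] -/
theorem re_qrot_neg_mul_conj (d : Fin 4) (c : ℂ) : (qrot (-d) * conj c).re = (qrot d * c).re := by
  rw [qrot_neg, ← map_mul, Complex.conj_re]

/-! ### §2 The step rule: a certified disc about one point from the Taylor data -/

section Hilbert

variable {X : Type*} [NormedAddCommGroup X] [InnerProductSpace ℂ X] [CompleteSpace X]
variable {U : Set ℂ} {J : ℂ → X →L[ℂ] X}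

/-- **THE STEP RULE.** For `E(w) = 1 − θ⟪h, J(w)f⟫` with `J` a pseudo-resolvent on `U ∋ s, w` and `‖J(w)g‖ ≤ ‖g‖/c_w`: the point datum
`‖E(s) − c‖ ≤ r`, the coefficient bounds `‖θ‖·‖⟪h, J(s)^{j+2}f⟫‖ ≤ K_j` (`j < q`) and the adjoint-chain bound
`‖θ‖·‖(J(s)†)^{q+1}h‖·‖f‖ ≤ Y` give, for `‖w − s‖ ≤ ρ`, `‖E(w) − c‖ ≤ r + Σ_{j<q} K_j ρ^{j+1} + Y ρ^{q+1}/c_w`. [folklore] -/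
theorem norm_evans_sub_le_of_taylor (hJ : IsPseudoResolvent U J) {s w : ℂ} (hs : s ∈ U) (hw : w ∈ U)
    {cw : ℝ} (hcw : 0 < cw) (hb : ∀ g, ‖J w g‖ ≤ ‖g‖ / cw) (h f : X) (θ c : ℂ) {E : ℂ → ℂ}
    (hE : ∀ z, E z = 1 - θ * ⟪h, J z f⟫_ℂ) {q : ℕ} {K : ℕ → ℝ} {r Y ρ : ℝ}
    (h0 : ‖E s - c‖ ≤ r) (hK : ∀ j < q, ‖θ‖ * ‖⟪h, (J s ^ (j + 2)) f⟫_ℂ‖ ≤ K j)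
    (hY : ‖θ‖ * ‖((ContinuousLinearMap.adjoint (J s)) ^ (q + 1)) h‖ * ‖f‖ ≤ Y) (hρ : ‖w - s‖ ≤ ρ) :
    ‖E w - c‖ ≤ r + (∑ j ∈ Finset.range q, K j * ρ ^ (j + 1)) + Y * ρ ^ (q + 1) / cw := by
  have hρ0 : 0 ≤ ρ := (norm_nonneg _).trans hρ
  have hsw : ‖s - w‖ ≤ ρ := by rwa [norm_sub_rev]
  have hrem := hJ.norm_inner_apply_sub_sum_le_of_bound hs hw (q + 1) h f hb
  rw [Finset.sum_range_succ', pow_zero, one_mul, zero_add, pow_one] at hrem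
  set T := ∑ j ∈ Finset.range q, (s - w) ^ (j + 1) * ⟪h, (J s ^ (j + 1 + 1)) f⟫_ℂ with hT
  set Rm := ⟪h, J w f⟫_ℂ - (T + ⟪h, J s f⟫_ℂ) with hRm
  have key : E w - c = (E s - c) - θ * T - θ * Rm := by
    rw [hE w, hE s, hRm]; ring
  -- the coefficient part
  have hTb : ‖θ * T‖ ≤ ∑ j ∈ Finset.range q, K j * ρ ^ (j + 1) := by
    rw [norm_mul, hT]
    calc ‖θ‖ * ‖∑ j ∈ Finset.range q, (s - w) ^ (j + 1) * ⟪h, (J s ^ (j + 1 + 1)) f⟫_ℂ‖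
        ≤ ‖θ‖ * ∑ j ∈ Finset.range q, ‖(s - w) ^ (j + 1) * ⟪h, (J s ^ (j + 1 + 1)) f⟫_ℂ‖ := by
          gcongr; exact norm_sum_le _ _
      _ = ∑ j ∈ Finset.range q, (‖θ‖ * ‖⟪h, (J s ^ (j + 2)) f⟫_ℂ‖) * ‖s - w‖ ^ (j + 1) := by
          rw [Finset.mul_sum]
          refine Finset.sum_congr rfl fun j _ => ?_
          rw [norm_mul, norm_pow]; ring
      _ ≤ ∑ j ∈ Finset.range q, K j * ρ ^ (j + 1) := Finset.sum_le_sum fun j hj => by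
          have hKj := hK j (Finset.mem_range.1 hj)
          have hK0 : 0 ≤ K j := le_trans (by positivity) hKj
          exact mul_le_mul hKj (pow_le_pow_left₀ (norm_nonneg _) hsw _) (by positivity) hK0
  -- the remainder part
  have hRb : ‖θ * Rm‖ ≤ Y * ρ ^ (q + 1) / cw := by
    rw [norm_mul]
    have hY0 : 0 ≤ Y := le_trans (by positivity) hY
    calc ‖θ‖ * ‖Rm‖ ≤ ‖θ‖ * (‖s - w‖ ^ (q + 1) * ‖((ContinuousLinearMap.adjoint (J s)) ^ (q + 1)) h‖ * ‖f‖ / cw) := by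
          gcongr
      _ = ‖s - w‖ ^ (q + 1) * (‖θ‖ * ‖((ContinuousLinearMap.adjoint (J s)) ^ (q + 1)) h‖ * ‖f‖) / cw := by ring
      _ ≤ ρ ^ (q + 1) * Y / cw := by
          gcongr
      _ = Y * ρ ^ (q + 1) / cw := by ring
  calc ‖E w - c‖ = ‖(E s - c) - θ * T - θ * Rm‖ := by rw [key]
    _ ≤ ‖E s - c‖ + ‖θ * T‖ + ‖θ * Rm‖ := by
        refine (norm_sub_le _ _).trans ?_
        gcongr
        exact norm_sub_le _ _
    _ ≤ r + (∑ j ∈ Finset.range q, K j * ρ ^ (j + 1)) + Y * ρ ^ (q + 1) / cw := by gcongr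


/-! ### §3 One vertical piece of the label certificate -/

/-- **ONE VERTICAL PIECE from the Taylor data at one point.** On the vertical line `Re = x` (every point of which lies in `U` with the bound
`‖J(x + iy)g‖ ≤ ‖g‖/c_w`), the data of `norm_evans_sub_le_of_taylor` at `s = x + i y_s`, a second function `E₁` with `‖E₁ − E‖ ≤ pert` on the
piece, `[y₀, y₁] ⊆ [y_s − ρ, y_s + ρ]`, and the MARGIN `r + pert + Σ_{j<q} K_j ρ^{j+1} + Y ρ^{q+1}/c_w < Re((−i)^d c)` give the `VPieces` clause
`Re((−i)^d · E₁(x + iy)) > 0` for all `y ∈ [y₀, y₁]`. [folklore] -/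
theorem vpiece_of_taylor (hJ : IsPseudoResolvent U J) {x ys : ℝ} (hU : ∀ y : ℝ, ((x : ℂ) + y * I) ∈ U)
    {cw : ℝ} (hcw : 0 < cw) (hb : ∀ (y : ℝ) (g : X), ‖J ((x : ℂ) + y * I) g‖ ≤ ‖g‖ / cw) (h f : X) (θ c : ℂ) {E E₁ : ℂ → ℂ}
    (hE : ∀ z, E z = 1 - θ * ⟪h, J z f⟫_ℂ) {q : ℕ} {K : ℕ → ℝ} {r Y ρ pert y₀ y₁ : ℝ} {d : Fin 4}
    (h0 : ‖E ((x : ℂ) + ys * I) - c‖ ≤ r) (hK : ∀ j < q, ‖θ‖ * ‖⟪h, (J ((x : ℂ) + ys * I) ^ (j + 2)) f⟫_ℂ‖ ≤ K j)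
    (hY : ‖θ‖ * ‖((ContinuousLinearMap.adjoint (J ((x : ℂ) + ys * I))) ^ (q + 1)) h‖ * ‖f‖ ≤ Y)
    (hpert : ∀ y ∈ Icc y₀ y₁, ‖E₁ ((x : ℂ) + y * I) - E ((x : ℂ) + y * I)‖ ≤ pert)
    (hlo : ys - ρ ≤ y₀) (hhi : y₁ ≤ ys + ρ)
    (hmargin : r + pert + (∑ j ∈ Finset.range q, K j * ρ ^ (j + 1)) + Y * ρ ^ (q + 1) / cw < (qrot d * c).re) :
    ∀ y ∈ Icc y₀ y₁, 0 < (qrot d * E₁ ((x : ℂ) + y * I)).re := by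
  intro y hy
  have hρ : ‖((x : ℂ) + y * I) - ((x : ℂ) + ys * I)‖ ≤ ρ := by
    have e : ((x : ℂ) + y * I) - ((x : ℂ) + ys * I) = ((y - ys : ℝ) : ℂ) * I := by push_cast; ring
    rw [e, norm_mul, Complex.norm_I, mul_one, Complex.norm_real, Real.norm_eq_abs, abs_le]
    constructor <;> linarith [hy.1, hy.2]
  have hdisc := norm_evans_sub_le_of_taylor hJ (hU ys) (hU y) hcw (hb y) h f θ c hE h0 hK hY hρ
  have hdisc₁ : ‖E₁ ((x : ℂ) + y * I) - c‖ ≤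
      r + pert + (∑ j ∈ Finset.range q, K j * ρ ^ (j + 1)) + Y * ρ ^ (q + 1) / cw := by
    calc ‖E₁ ((x : ℂ) + y * I) - c‖ ≤ ‖E₁ ((x : ℂ) + y * I) - E ((x : ℂ) + y * I)‖ + ‖E ((x : ℂ) + y * I) - c‖ :=
          norm_sub_le_norm_sub_add_norm_sub _ _ _
      _ ≤ pert + (r + (∑ j ∈ Finset.range q, K j * ρ ^ (j + 1)) + Y * ρ ^ (q + 1) / cw) := add_le_add (hpert y hy) hdisc
      _ = _ := by ring
  exact re_qrot_mul_pos_of_norm_sub_le hdisc₁ hmargin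

/-! ### §4 Conjugate transfer -/

omit [CompleteSpace X] in
/-- A certified disc at the mirror image: if `E(w̄) = conj E(w)` for all `w` and `‖E(x + iy) − c‖ ≤ R` on `[y₀, y₁]`, then
`‖E(x + iy) − conj c‖ ≤ R` on `[−y₁, −y₀]`. [folklore] -/
theorem disc_conj {E : ℂ → ℂ} (hsym : ∀ w, E (conj w) = conj (E w)) {x y₀ y₁ R : ℝ} {c : ℂ}
    (h : ∀ y ∈ Icc y₀ y₁, ‖E ((x : ℂ) + y * I) - c‖ ≤ R) :
    ∀ y ∈ Icc (-y₁) (-y₀), ‖E ((x : ℂ) + y * I) - conj c‖ ≤ R := by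
  intro y hy
  have hy' : -y ∈ Icc y₀ y₁ := ⟨by linarith [hy.2], by linarith [hy.1]⟩
  have e : ((x : ℂ) + y * I) = conj ((x : ℂ) + ((-y : ℝ) : ℂ) * I) := by
    apply Complex.ext <;> simp
  rw [e, hsym, ← map_sub, Complex.norm_conj]
  exact h (-y) hy'

omit [CompleteSpace X] in
/-- **The mirror piece.** If `E(w̄) = conj E(w)`, `‖E − c‖ ≤ R` on the piece `[y₀, y₁]` of `Re = x`, a second function `E₁` satisfies
`‖E₁ − E‖ ≤ pert` on a piece `[a, b] ⊆ [−y₁, −y₀]`, and `R + pert < Re((−i)^d c)`, then `Re((−i)^{d′} E₁(x + iy)) > 0` on `[a, b]` for the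
mirror label `d′ = −d` (`1 ↔ 3` swapped, `0, 2` kept). [folklore] -/
theorem vpiece_conj {E E₁ : ℂ → ℂ} (hsym : ∀ w, E (conj w) = conj (E w)) {x y₀ y₁ R pert a b : ℝ} {c : ℂ} {d d' : Fin 4}
    (h : ∀ y ∈ Icc y₀ y₁, ‖E ((x : ℂ) + y * I) - c‖ ≤ R)
    (hpert : ∀ y ∈ Icc a b, ‖E₁ ((x : ℂ) + y * I) - E ((x : ℂ) + y * I)‖ ≤ pert)
    (ha : -y₁ ≤ a) (hb : b ≤ -y₀) (hd : d' = -d) (hmargin : R + pert < (qrot d * c).re) :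
    ∀ y ∈ Icc a b, 0 < (qrot d' * E₁ ((x : ℂ) + y * I)).re := by
  intro y hy
  have hy' : y ∈ Icc (-y₁) (-y₀) := ⟨ha.trans hy.1, hy.2.trans hb⟩
  have h1 := disc_conj hsym h y hy'
  have h2 : ‖E₁ ((x : ℂ) + y * I) - conj c‖ ≤ R + pert := by
    calc ‖E₁ ((x : ℂ) + y * I) - conj c‖ ≤ ‖E₁ ((x : ℂ) + y * I) - E ((x : ℂ) + y * I)‖ + ‖E ((x : ℂ) + y * I) - conj c‖ :=
          norm_sub_le_norm_sub_add_norm_sub _ _ _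
      _ ≤ pert + R := add_le_add (hpert y hy) h1
      _ = R + pert := add_comm _ _
  rw [hd]
  exact re_qrot_mul_pos_of_norm_sub_le h2 (by rwa [re_qrot_neg_mul_conj])

/-- **The certified disc of a piece** (the `E`-only output of the step rule, to be mirrored by `vpiece_conj`): under the hypotheses of
`vpiece_of_taylor` without `E₁`/margin, `‖E(x + iy) − c‖ ≤ r + Σ_{j<q} K_j ρ^{j+1} + Y ρ^{q+1}/c_w` on `[y₀, y₁]`. [folklore] -/
theorem disc_of_taylor (hJ : IsPseudoResolvent U J) {x ys : ℝ} (hU : ∀ y : ℝ, ((x : ℂ) + y * I) ∈ U)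
    {cw : ℝ} (hcw : 0 < cw) (hb : ∀ (y : ℝ) (g : X), ‖J ((x : ℂ) + y * I) g‖ ≤ ‖g‖ / cw) (h f : X) (θ c : ℂ) {E : ℂ → ℂ}
    (hE : ∀ z, E z = 1 - θ * ⟪h, J z f⟫_ℂ) {q : ℕ} {K : ℕ → ℝ} {r Y ρ y₀ y₁ : ℝ}
    (h0 : ‖E ((x : ℂ) + ys * I) - c‖ ≤ r) (hK : ∀ j < q, ‖θ‖ * ‖⟪h, (J ((x : ℂ) + ys * I) ^ (j + 2)) f⟫_ℂ‖ ≤ K j)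
    (hY : ‖θ‖ * ‖((ContinuousLinearMap.adjoint (J ((x : ℂ) + ys * I))) ^ (q + 1)) h‖ * ‖f‖ ≤ Y)
    (hlo : ys - ρ ≤ y₀) (hhi : y₁ ≤ ys + ρ) :
    ∀ y ∈ Icc y₀ y₁, ‖E ((x : ℂ) + y * I) - c‖ ≤ r + (∑ j ∈ Finset.range q, K j * ρ ^ (j + 1)) + Y * ρ ^ (q + 1) / cw := by
  intro y hy
  have hρ : ‖((x : ℂ) + y * I) - ((x : ℂ) + ys * I)‖ ≤ ρ := by
    have e : ((x : ℂ) + y * I) - ((x : ℂ) + ys * I) = ((y - ys : ℝ) : ℂ) * I := by push_cast; ring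
    rw [e, norm_mul, Complex.norm_I, mul_one, Complex.norm_real, Real.norm_eq_abs, abs_le]
    constructor <;> linarith [hy.1, hy.2]
  exact norm_evans_sub_le_of_taylor hJ (hU ys) (hU y) hcw (hb y) h f θ c hE h0 hK hY hρ

/-! ### §4b The point record as ONE named hypothesis, and the two piece rules keyed on it -/

/-- **A point record of the certificate** (the shape of ONE entry of implementation 2's `s2_impl2.json`, by name): at the point `s`,
the Evans box `‖E(s) − c‖ ≤ r`, the coefficient bounds `‖θ‖·‖⟪h, J(s)^{j+2}f⟫‖ ≤ Ks[j]` (`j < |Ks|`; = `|k_{j+1}| + err_{j+1}`), and the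
adjoint-chain bound `‖θ‖·‖(J(s)†)^{|Ks|+1}h‖·‖f‖ ≤ Y` (= `θ(‖ỹ_p‖ + e_p)‖h‖`, `p = |Ks| + 1`). For the sheet this is implementation 2's
interval arithmetic; it is NOT proved in the tree. [folklore] -/
def TaylorDatum (J : ℂ → X →L[ℂ] X) (h f : X) (θ : ℂ) (E : ℂ → ℂ) (s c : ℂ) (r : ℝ) (Ks : List ℝ) (Y : ℝ) : Prop :=
  ‖E s - c‖ ≤ r ∧ (∀ j < Ks.length, ‖θ‖ * ‖⟪h, (J s ^ (j + 2)) f⟫_ℂ‖ ≤ Ks.getD j 0) ∧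
    ‖θ‖ * ‖((ContinuousLinearMap.adjoint (J s)) ^ (Ks.length + 1)) h‖ * ‖f‖ ≤ Y

/-- **UPPER PIECE from a point record**: `TaylorDatum` at `s = x + i y_s`, `‖E₁ − E‖ ≤ pert` on `[y₀, y₁] ⊆ [y_s − ρ, y_s + ρ]`, and the
margin `r + pert + Σ_j Ks[j] ρ^{j+1} + Y ρ^{|Ks|+1}/c_w < Re((−i)^d c)` ⇒ `Re((−i)^d E₁(x + iy)) > 0` on `[y₀, y₁]`. [folklore] -/
theorem vpiece_of_datum (hJ : IsPseudoResolvent U J) {x ys : ℝ} (hU : ∀ y : ℝ, ((x : ℂ) + y * I) ∈ U)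
    {cw : ℝ} (hcw : 0 < cw) (hb : ∀ (y : ℝ) (g : X), ‖J ((x : ℂ) + y * I) g‖ ≤ ‖g‖ / cw) {h f : X} {θ c : ℂ} {E E₁ : ℂ → ℂ}
    (hE : ∀ z, E z = 1 - θ * ⟪h, J z f⟫_ℂ) {Ks : List ℝ} {r Y ρ pert y₀ y₁ : ℝ} {d : Fin 4}
    (hD : TaylorDatum J h f θ E ((x : ℂ) + ys * I) c r Ks Y)
    (hpert : ∀ y ∈ Icc y₀ y₁, ‖E₁ ((x : ℂ) + y * I) - E ((x : ℂ) + y * I)‖ ≤ pert)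
    (hlo : ys - ρ ≤ y₀) (hhi : y₁ ≤ ys + ρ)
    (hmargin : r + pert + (∑ j ∈ Finset.range Ks.length, Ks.getD j 0 * ρ ^ (j + 1)) + Y * ρ ^ (Ks.length + 1) / cw < (qrot d * c).re) :
    ∀ y ∈ Icc y₀ y₁, 0 < (qrot d * E₁ ((x : ℂ) + y * I)).re :=
  vpiece_of_taylor hJ hU hcw hb h f θ c hE hD.1 hD.2.1 hD.2.2 hpert hlo hhi hmargin

/-- **LOWER (mirror) PIECE from a point record**: the same record, the symmetry `E(w̄) = conj E(w)`, `‖E₁ − E‖ ≤ pert` on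
`[a, b] ⊆ [−(y_s + ρ), −(y_s − ρ)]`… precisely `[a, b] ⊆ [−y₁, −y₀]` with `[y₀, y₁] ⊆ [y_s − ρ, y_s + ρ]`, the mirror label `d′ = −d`, and the
same margin ⇒ `Re((−i)^{d′} E₁(x + iy)) > 0` on `[a, b]`. [folklore] -/
theorem vpiece_conj_of_datum (hJ : IsPseudoResolvent U J) {x ys : ℝ} (hU : ∀ y : ℝ, ((x : ℂ) + y * I) ∈ U)
    {cw : ℝ} (hcw : 0 < cw) (hb : ∀ (y : ℝ) (g : X), ‖J ((x : ℂ) + y * I) g‖ ≤ ‖g‖ / cw) {h f : X} {θ c : ℂ} {E E₁ : ℂ → ℂ}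
    (hE : ∀ z, E z = 1 - θ * ⟪h, J z f⟫_ℂ) (hsym : ∀ w, E (conj w) = conj (E w)) {Ks : List ℝ} {r Y ρ pert y₀ y₁ a b : ℝ} {d d' : Fin 4}
    (hD : TaylorDatum J h f θ E ((x : ℂ) + ys * I) c r Ks Y)
    (hpert : ∀ y ∈ Icc a b, ‖E₁ ((x : ℂ) + y * I) - E ((x : ℂ) + y * I)‖ ≤ pert)
    (hlo : ys - ρ ≤ y₀) (hhi : y₁ ≤ ys + ρ) (ha : -y₁ ≤ a) (hb' : b ≤ -y₀) (hd : d' = -d)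
    (hmargin : r + pert + (∑ j ∈ Finset.range Ks.length, Ks.getD j 0 * ρ ^ (j + 1)) + Y * ρ ^ (Ks.length + 1) / cw < (qrot d * c).re) :
    ∀ y ∈ Icc a b, 0 < (qrot d' * E₁ ((x : ℂ) + y * I)).re := by
  have hdisc := disc_of_taylor hJ hU hcw hb h f θ c hE (y₀ := y₀) (y₁ := y₁) hD.1 hD.2.1 hD.2.2 hlo hhi
  refine vpiece_conj hsym hdisc hpert ha hb' hd ?_
  linarith

/-! ### §5 The mixed far field: one forward and one adjoint step -/

/-- The adjoint family `w ↦ J(w̄)†` of a pseudo-resolvent is a pseudo-resolvent on the mirror set. [folklore] -/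
theorem isPseudoResolvent_adjoint (hJ : IsPseudoResolvent U J) :
    IsPseudoResolvent {w : ℂ | conj w ∈ U} (fun w => ContinuousLinearMap.adjoint (J (conj w))) := by
  intro a ha b hb
  simp only [Set.mem_setOf_eq] at ha hb
  have h1 := hJ hb ha
  show ContinuousLinearMap.adjoint (J (conj a)) - ContinuousLinearMap.adjoint (J (conj b)) =
    (b - a) • (ContinuousLinearMap.adjoint (J (conj a)) * ContinuousLinearMap.adjoint (J (conj b)))
  have h3 : ContinuousLinearMap.adjoint (J (conj b)) - ContinuousLinearMap.adjoint (J (conj a)) =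
      (a - b) • (ContinuousLinearMap.adjoint (J (conj a)) * ContinuousLinearMap.adjoint (J (conj b))) := by
    rw [← map_sub, h1, LinearIsometryEquiv.map_smulₛₗ, ContinuousLinearMap.mul_def, ContinuousLinearMap.adjoint_comp,
      ← ContinuousLinearMap.mul_def, map_sub, starRingEnd_self_apply, starRingEnd_self_apply]
  rw [← neg_sub, h3, ← neg_smul, neg_sub]

/-- **The adjoint step** in resolvent-only form: if `J(z)†(g′ + z̄ h) = h` («`A† h = g′`») then at every `σ ∈ U`, `σ ≠ 0`:
`J(σ)† h = σ̄⁻¹ h − σ̄⁻¹ J(σ)† g′` (`apply_eq_inv_smul_sub` for the adjoint family). [folklore] -/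
theorem adjoint_apply_eq_inv_smul_sub (hJ : IsPseudoResolvent U J) {z σ : ℂ} (hz : z ∈ U) (hσ : σ ∈ U) (hσ0 : σ ≠ 0)
    {h g' : X} (hh : ContinuousLinearMap.adjoint (J z) (g' + conj z • h) = h) :
    ContinuousLinearMap.adjoint (J σ) h = (conj σ)⁻¹ • h - (conj σ)⁻¹ • ContinuousLinearMap.adjoint (J σ) g' := by
  have hJ' := isPseudoResolvent_adjoint hJ
  have hz' : conj z ∈ {w : ℂ | conj w ∈ U} := by simp [hz]
  have hσ' : conj σ ∈ {w : ℂ | conj w ∈ U} := by simp [hσ]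
  have hσ0' : conj σ ≠ 0 := by simpa using hσ0
  have hh' : h = (fun w => ContinuousLinearMap.adjoint (J (conj w))) (conj z) (g' + conj z • h) := by
    simpa using hh.symm
  have key := hJ'.apply_eq_inv_smul_sub hz' hσ' hσ0' hh'
  simpa using key

/-- **THE MIXED EXPANSION** (one forward step on `f`, one adjoint step on `h`): with `f = J(z)(g₁ + z f)` («`A f = g₁`») and
`J(z)†(g₁′ + z̄ h) = h` («`A† h = g₁′`»), for every `σ ∈ U ∖ {0}`:
`⟪h, J(σ)f⟫ = σ⁻¹⟪h, f⟫ − σ⁻²⟪h, g₁⟫ + σ⁻²⟪g₁′, J(σ)g₁⟫` — implementation 2's mixed order-2 far-field form. [folklore] -/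
theorem inner_apply_eq_mixed (hJ : IsPseudoResolvent U J) {z σ : ℂ} (hz : z ∈ U) (hσ : σ ∈ U) (hσ0 : σ ≠ 0)
    {h f g₁ g₁' : X} (hf : f = J z (g₁ + z • f)) (hh : ContinuousLinearMap.adjoint (J z) (g₁' + conj z • h) = h) :
    ⟪h, J σ f⟫_ℂ = σ⁻¹ * ⟪h, f⟫_ℂ - σ⁻¹ ^ 2 * ⟪h, g₁⟫_ℂ + σ⁻¹ ^ 2 * ⟪g₁', J σ g₁⟫_ℂ := by
  have h1 := hJ.apply_eq_inv_smul_sub hz hσ hσ0 hf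
  have h2 := adjoint_apply_eq_inv_smul_sub hJ hz hσ hσ0 hh
  have hcc : conj ((conj σ)⁻¹) = σ⁻¹ := by rw [map_inv₀, starRingEnd_self_apply]
  have h3 : ⟪h, J σ g₁⟫_ℂ = σ⁻¹ * ⟪h, g₁⟫_ℂ - σ⁻¹ * ⟪g₁', J σ g₁⟫_ℂ := by
    rw [← ContinuousLinearMap.adjoint_inner_left, h2, inner_sub_left, inner_smul_left, inner_smul_left,
      ContinuousLinearMap.adjoint_inner_left, hcc]
  rw [h1, inner_sub_right, inner_smul_right, inner_smul_right, h3]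
  ring

/-- **The mixed far-field bound**: under the two steps, `‖σ‖ ≥ R > 0`, and `‖J(σ)g‖ ≤ ‖g‖/c_σ` with `0 < c₀ ≤ c_σ`:
`‖θ⟪h, J(σ)f⟫‖ ≤ ‖θ‖·(‖⟪h,f⟫‖/R + ‖⟪h,g₁⟫‖/R² + ‖g₁′‖‖g₁‖/(c₀R²))`. [folklore] -/
theorem norm_k_le_mixed (hJ : IsPseudoResolvent U J) {z σ : ℂ} (hz : z ∈ U) (hσ : σ ∈ U)
    {h f g₁ g₁' : X} (hf : f = J z (g₁ + z • f)) (hh : ContinuousLinearMap.adjoint (J z) (g₁' + conj z • h) = h)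
    {R c₀ cσ : ℝ} (hR : 0 < R) (hRσ : R ≤ ‖σ‖) (hc₀ : 0 < c₀) (hcσ : c₀ ≤ cσ) (hb : ∀ g, ‖J σ g‖ ≤ ‖g‖ / cσ) (θ : ℂ) :
    ‖θ * ⟪h, J σ f⟫_ℂ‖ ≤ ‖θ‖ * (‖⟪h, f⟫_ℂ‖ / R + ‖⟪h, g₁⟫_ℂ‖ / R ^ 2 + ‖g₁'‖ * ‖g₁‖ / (c₀ * R ^ 2)) := by
  have hσpos : 0 < ‖σ‖ := lt_of_lt_of_le hR hRσ
  have hσ0 : σ ≠ 0 := fun h0 => by rw [h0, norm_zero] at hσpos; exact lt_irrefl _ hσpos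
  have hinv : ‖σ⁻¹‖ ≤ R⁻¹ := by rw [norm_inv, inv_le_inv₀ hσpos hR]; exact hRσ
  have hinv2 : ‖σ⁻¹‖ ^ 2 ≤ (R ^ 2)⁻¹ := by rw [← inv_pow]; exact pow_le_pow_left₀ (norm_nonneg _) hinv 2
  have hcσ0 : 0 < cσ := lt_of_lt_of_le hc₀ hcσ
  have hlast : ‖⟪g₁', J σ g₁⟫_ℂ‖ ≤ ‖g₁'‖ * ‖g₁‖ / c₀ := by
    calc ‖⟪g₁', J σ g₁⟫_ℂ‖ ≤ ‖g₁'‖ * ‖J σ g₁‖ := norm_inner_le_norm _ _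
      _ ≤ ‖g₁'‖ * (‖g₁‖ / cσ) := by gcongr; exact hb g₁
      _ ≤ ‖g₁'‖ * (‖g₁‖ / c₀) := by gcongr
      _ = ‖g₁'‖ * ‖g₁‖ / c₀ := by ring
  rw [norm_mul, inner_apply_eq_mixed hJ hz hσ hσ0 hf hh]
  refine mul_le_mul_of_nonneg_left ?_ (norm_nonneg θ)
  calc ‖σ⁻¹ * ⟪h, f⟫_ℂ - σ⁻¹ ^ 2 * ⟪h, g₁⟫_ℂ + σ⁻¹ ^ 2 * ⟪g₁', J σ g₁⟫_ℂ‖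
      ≤ ‖σ⁻¹ * ⟪h, f⟫_ℂ‖ + ‖σ⁻¹ ^ 2 * ⟪h, g₁⟫_ℂ‖ + ‖σ⁻¹ ^ 2 * ⟪g₁', J σ g₁⟫_ℂ‖ :=
        (norm_add_le _ _).trans (by gcongr; exact norm_sub_le _ _)
    _ = ‖σ⁻¹‖ * ‖⟪h, f⟫_ℂ‖ + ‖σ⁻¹‖ ^ 2 * ‖⟪h, g₁⟫_ℂ‖ + ‖σ⁻¹‖ ^ 2 * ‖⟪g₁', J σ g₁⟫_ℂ‖ := by
        rw [norm_mul, norm_mul, norm_mul, norm_pow]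
    _ ≤ R⁻¹ * ‖⟪h, f⟫_ℂ‖ + (R ^ 2)⁻¹ * ‖⟪h, g₁⟫_ℂ‖ + (R ^ 2)⁻¹ * (‖g₁'‖ * ‖g₁‖ / c₀) := by
        gcongr
    _ = ‖⟪h, f⟫_ℂ‖ / R + ‖⟪h, g₁⟫_ℂ‖ / R ^ 2 + ‖g₁'‖ * ‖g₁‖ / (c₀ * R ^ 2) := by
        field_simp

/-- **Far field ⇒ right half-plane.** If the mixed bracket with literal bounds `‖⟪h,f⟫‖ ≤ B₁`, `‖⟪h,g₁⟫‖ ≤ B₂`, `‖g₁‖ ≤ G₁`, `‖g₁′‖ ≤ G₁′`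
satisfies `‖θ‖(B₁/R + B₂/R² + G₁′G₁/(c₀R²)) + pert < 1`, then every `E₁` with `‖E₁(σ) − E(σ)‖ ≤ pert` has `Re E₁(σ) > 0` (label `0`) at
every `σ ∈ U` with `‖σ‖ ≥ R` and `‖J(σ)g‖ ≤ ‖g‖/c_σ`, `c₀ ≤ c_σ`. [folklore] -/
theorem re_pos_of_mixed (hJ : IsPseudoResolvent U J) {z σ : ℂ} (hz : z ∈ U) (hσ : σ ∈ U)
    {h f g₁ g₁' : X} (hf : f = J z (g₁ + z • f)) (hh : ContinuousLinearMap.adjoint (J z) (g₁' + conj z • h) = h)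
    {R c₀ cσ : ℝ} (hR : 0 < R) (hRσ : R ≤ ‖σ‖) (hc₀ : 0 < c₀) (hcσ : c₀ ≤ cσ) (hb : ∀ g, ‖J σ g‖ ≤ ‖g‖ / cσ) (θ : ℂ)
    {E E₁ : ℂ → ℂ} (hE : ∀ w, E w = 1 - θ * ⟪h, J w f⟫_ℂ) {pert B₁ B₂ G₁ G₁' : ℝ} (hpert : ‖E₁ σ - E σ‖ ≤ pert)
    (hB₁ : ‖⟪h, f⟫_ℂ‖ ≤ B₁) (hB₂ : ‖⟪h, g₁⟫_ℂ‖ ≤ B₂) (hG₁ : ‖g₁‖ ≤ G₁) (hG₁' : ‖g₁'‖ ≤ G₁')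
    (hlt : ‖θ‖ * (B₁ / R + B₂ / R ^ 2 + G₁' * G₁ / (c₀ * R ^ 2)) + pert < 1) :
    0 < (E₁ σ).re := by
  have hk := norm_k_le_mixed hJ hz hσ hf hh hR hRσ hc₀ hcσ hb θ
  have hG0 : 0 ≤ G₁ := (norm_nonneg _).trans hG₁
  have hG0' : 0 ≤ G₁' := (norm_nonneg _).trans hG₁'
  have hk' : ‖θ * ⟪h, J σ f⟫_ℂ‖ ≤ ‖θ‖ * (B₁ / R + B₂ / R ^ 2 + G₁' * G₁ / (c₀ * R ^ 2)) := by
    refine hk.trans (mul_le_mul_of_nonneg_left ?_ (norm_nonneg θ))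
    gcongr
  have e : E₁ σ = 1 - θ * ⟪h, J σ f⟫_ℂ + (E₁ σ - E σ) := by rw [hE σ]; ring
  rw [e, Complex.add_re, Complex.sub_re, Complex.one_re]
  have h1 : |(θ * ⟪h, J σ f⟫_ℂ).re| ≤ ‖θ * ⟪h, J σ f⟫_ℂ‖ := Complex.abs_re_le_norm _
  have h2 : |(E₁ σ - E σ).re| ≤ ‖E₁ σ - E σ‖ := Complex.abs_re_le_norm _
  rw [abs_le] at h1 h2
  linarith [h1.2, h2.1]

/-- **A far-field record** (the shape of implementation 2's `far.json`, by name): ONE forward step `f = J(z)(g₁ + z f)` («`A f = g₁`»), ONE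
adjoint step `J(z)†(g₁′ + z̄ h) = h` («`A† h = g₁′`»), and the four scalars `‖⟪h,f⟫‖ ≤ B₁` (= `‖h‖²_w` when `f = h`), `‖⟪h,g₁⟫‖ ≤ B₂`,
`‖g₁‖ ≤ G₁`, `‖g₁′‖ ≤ G₁′` (finite parts + tails). For the sheet this is implementation 2's arithmetic + frame algebra; it is NOT proved in
the tree. [folklore] -/
def MixedFarDatum (J : ℂ → X →L[ℂ] X) (h f : X) (z : ℂ) (B₁ B₂ G₁ G₁' : ℝ) : Prop :=
  ∃ g₁ g₁' : X, f = J z (g₁ + z • f) ∧ ContinuousLinearMap.adjoint (J z) (g₁' + conj z • h) = h ∧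
    ‖⟪h, f⟫_ℂ‖ ≤ B₁ ∧ ‖⟪h, g₁⟫_ℂ‖ ≤ B₂ ∧ ‖g₁‖ ≤ G₁ ∧ ‖g₁'‖ ≤ G₁'

/-- **Far field ⇒ right half-plane, keyed on the record**: `MixedFarDatum … z B₁ B₂ G₁ G₁′`, `‖E₁(σ) − E(σ)‖ ≤ pert`,
`‖θ‖(B₁/R + B₂/R² + G₁′G₁/(c₀R²)) + pert < 1`, `‖σ‖ ≥ R`, `‖J(σ)g‖ ≤ ‖g‖/c_σ` with `c₀ ≤ c_σ` ⇒ `Re E₁(σ) > 0`. [folklore] -/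
theorem re_pos_of_mixedDatum (hJ : IsPseudoResolvent U J) {z σ : ℂ} (hz : z ∈ U) (hσ : σ ∈ U) {h f : X} {θ : ℂ}
    {B₁ B₂ G₁ G₁' : ℝ} (hD : MixedFarDatum J h f z B₁ B₂ G₁ G₁')
    {R c₀ cσ : ℝ} (hR : 0 < R) (hRσ : R ≤ ‖σ‖) (hc₀ : 0 < c₀) (hcσ : c₀ ≤ cσ) (hb : ∀ g, ‖J σ g‖ ≤ ‖g‖ / cσ)
    {E E₁ : ℂ → ℂ} (hE : ∀ w, E w = 1 - θ * ⟪h, J w f⟫_ℂ) {pert : ℝ} (hpert : ‖E₁ σ - E σ‖ ≤ pert)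
    (hlt : ‖θ‖ * (B₁ / R + B₂ / R ^ 2 + G₁' * G₁ / (c₀ * R ^ 2)) + pert < 1) :
    0 < (E₁ σ).re := by
  obtain ⟨g₁, g₁', hf, hh, hB₁, hB₂, hG₁, hG₁'⟩ := hD
  exact re_pos_of_mixed hJ hz hσ hf hh hR hRσ hc₀ hcσ hb θ hE hpert hB₁ hB₂ hG₁ hG₁' hlt

/-- The label-`0` form (`qrot 0 = 1`). [folklore] -/
theorem re_qrot_zero_mul (w : ℂ) : (qrot 0 * w).re = w.re := by
  simp [qrot]

end Hilbert

end SheetRSpectrumStepRule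
end Summit.NavierStokesRegularity.OSWSelfSimilar

end
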